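import Summits.BirchSwinnertonDyer.Rank1Residual.Additive.RamifiedSevenIntegralComparisonOfInputs
import HarnessLib

set_option autoImplicit false

/-!
# `𝒞₇` genus road (crux `EllipticUnitValueSevenOfGZK`, K7r) — the K2ᶜ divisibility input as an INTEGER INEQUALITY
# (bsd-idea-20 g65, crux workfile; companion of `FbPreregistration-g65.md` §5 and of the cell's block (R) letters
# `DualExpValueDatum.cZ/jα/wα` (p781874) and `periodScaledComparisonShape_of_inputs` (announced d06c5d2120e2ab1f))

REV 1.2 (2026-08-30T18:27Z): §3 ADDED — the typer's ASSEMBLY `RamifiedSevenIntegralComparisonOfInputs.lean` (p782137 ACCEPTED 18:10Z, tree sha16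
f1afb5442cf8426f) is in the tree; §3 restates its `integralComparisonShape_of_inputs` and ★ `integralComparisonSeven_of_inputs` with the divisibility binder
`hKI : Φ.π ^ (m₀ + 2 * D.jα) ∣ D.cZ * t′` REPLACED by the (F-b) letter: `IsUnit Φ.t ∧ PeriodPositionField D` (unit-`t` gauge, (C-t)) or
`t′ = w′·π^{m′} ∧ PeriodPositionFieldAt D m₀ m′` (general gauge) — an ALTERNATIVE residual letter for the pen's v13 `stub_integralComparisonInputsSeven`,
one comparison of naturals instead of a ring divisibility; the import is now the assembly file (which imports the datum file).
REV 1.1 (2026-08-30T18:16Z): §2 ADDED — the same statements READ ON THE LANDED DATUM `DualExpValueDatum` of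
`RamifiedSevenGenusKatoExpFrame.lean` (p781874 ACCEPTED 17:56Z, tree sha16 9d418fe365a1bcf8), i.e. the (F-b) letter `PeriodPositionField` typed
against the real `D.jα`, `D.e`, `Φ.k`, `Φ.a`, and `PeriodPositionField(At) ⟹ Φ.π ^ (m₀ + 2·D.jα) ∣ D.cZ * t′` — the pen's D916 assembly input
verbatim.  REV 1 (commit 9fe4135b9404, `import Mathlib` only) is §1 below, unchanged except that the import is now the road's datum file.

§1 — PURE ALGEBRA over an arbitrary commutative ring `R` with an element `π` and ANY `v` such that `7 = v·π²` (the frame's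
`KatoGenusFrame.seven_eq`; `v` need not be a unit here).  No frame, no datum, no import from the road; nothing asserted, no
named fact, no `sorry`.  Three statements:

* `pow_dvd_intCast_sub_intCast_mul` — for integers `α₀, α₁` and every `j` with `7^j ∣ α₀² + 7α₁²`:  `π^j ∣ (α₀ − α₁·π)` in `R`.
  (Induction with step 2: `7 ∣ α₀² + 7α₁² ⇒ 7 ∣ α₀ ⇒ α₀ − α₁π = π·(vπa − α₁)`; `49 ∣ … ⇒ 7 ∣ α₀ ∧ 7 ∣ α₁ ⇒ α₀ − α₁π = vπ²·(a − bπ)`.)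
* `seven_pow_factorization_dvd_norm` — `7^{jα} ∣ α₀² + 7α₁²` for `jα := (α₀² + 7α₁²).toNat.factorization 7` (the letter of
  `DualExpValueDatum.jα`).
* `pow_dvd_constZ_mul_of_le` — CONSEQUENTLY the divisibility input of the pen's D916 assembly,
  `π^(m₀ + 2jα) ∣ cZ·t′` with `cZ = (α₀ − α₁π)·7^e·w·(7^k·(u·π^a))` (the body of `DualExpValueDatum.cZ`, `w` standing for the
  image of `uStar⁻¹`, `u` for `Φ.u`) and `t′ = w′·π^{m′}`, FOLLOWS from the integer inequality
  `m₀ + 2jα ≤ jα + 2e + 2k + a + m′`, i.e. from `jα + (m₀ − m′) ≤ 2e + 2k + a` — the (F-b) pre-registration's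
  `PeriodPositionField` in the general `t`-gauge (`m₀ − m′ = v_π(t)`); in the `t = t′ = 1`, `m₀ = 0` gauge it reads
  `jα ≤ 2e + 2k + a` (`pow_dvd_constZ_of_le`).  The pre-registered PREDICTION for genuine data is EQUALITY `jα = 2(e+k) + a_W`
  (memo §2 (P1)); this file only shows that the inequality suffices for the typed divisibility, in ANY frame ring.

HONEST LABEL: algebra only; no stub of zp v12 closes by this; 19945 OPEN; BSD claimed for no curve.
[cite: Kato2004Asterisque, (15.16.1) (p. 265)]
-/

namespace Summit.BirchSwinnertonDyer.Rank1Residual.Additive.GenusSeven.FbKernelInteger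

section Divisibility

variable {R : Type*} [CommRing R]

/-- **`π^j ∣ α₀ − α₁π` whenever `7^j ∣ α₀² + 7α₁²`**, in any commutative ring with `7 = v·π²`.
[cite: Kato2004Asterisque, (15.16.1) (p. 265)] -/
theorem pow_dvd_intCast_sub_intCast_mul (π v : R) (h7 : (7 : R) = v * π ^ 2) :
    ∀ (j : ℕ) (α₀ α₁ : ℤ), (7 : ℤ) ^ j ∣ α₀ ^ 2 + 7 * α₁ ^ 2 → π ^ j ∣ ((α₀ : R) - (α₁ : R) * π) := by
  have h7p : Prime (7 : ℤ) := Int.prime_iff_natAbs_prime.2 (by norm_num)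
  intro j
  induction j using Nat.strong_induction_on with
  | _ j ih =>
    intro α₀ α₁ hdvd
    match j, ih, hdvd with
    | 0, _, _ => exact ⟨(α₀ : R) - (α₁ : R) * π, by ring⟩
    | 1, _, hdvd =>
      have h7N : (7 : ℤ) ∣ α₀ ^ 2 + 7 * α₁ ^ 2 := by simpa using hdvd
      have h7a : (7 : ℤ) ∣ α₀ ^ 2 := (dvd_add_left (dvd_mul_right (7 : ℤ) (α₁ ^ 2))).mp h7N
      obtain ⟨a, rfl⟩ := h7p.dvd_of_dvd_pow h7a
      refine ⟨v * π * (a : R) - (α₁ : R), ?_⟩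
      push_cast
      rw [h7]
      ring
    | j + 2, ih, hdvd =>
      have h7N : (7 : ℤ) ∣ α₀ ^ 2 + 7 * α₁ ^ 2 :=
        (dvd_pow_self (7 : ℤ) (by omega : j + 2 ≠ 0)).trans hdvd
      have h7a : (7 : ℤ) ∣ α₀ ^ 2 := (dvd_add_left (dvd_mul_right (7 : ℤ) (α₁ ^ 2))).mp h7N
      obtain ⟨a, rfl⟩ := h7p.dvd_of_dvd_pow h7a
      have h49 : (7 : ℤ) ^ 2 ∣ (7 * a) ^ 2 + 7 * α₁ ^ 2 :=
        (pow_dvd_pow (7 : ℤ) (by omega : 2 ≤ j + 2)).trans hdvd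
      have h49' : (7 : ℤ) * 7 ∣ 7 * α₁ ^ 2 := by
        have h1 : (7 : ℤ) ^ 2 ∣ (7 * a) ^ 2 := ⟨a ^ 2, by ring⟩
        have h2 := (dvd_add_right h1).mp h49
        simpa [pow_two] using h2
      have h7b2 : (7 : ℤ) ∣ α₁ ^ 2 := (mul_dvd_mul_iff_left (by norm_num : (7 : ℤ) ≠ 0)).mp h49'
      obtain ⟨b, rfl⟩ := h7p.dvd_of_dvd_pow h7b2
      have hj : (7 : ℤ) ^ j ∣ a ^ 2 + 7 * b ^ 2 := by
        have h1 : (7 : ℤ) ^ (j + 2) = 7 ^ 2 * 7 ^ j := by ring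
        have h2 : (7 * a) ^ 2 + 7 * (7 * b) ^ 2 = (7 : ℤ) ^ 2 * (a ^ 2 + 7 * b ^ 2) := by ring
        rw [h1, h2] at hdvd
        exact (mul_dvd_mul_iff_left (by positivity : (7 : ℤ) ^ 2 ≠ 0)).mp hdvd
      obtain ⟨c, hc⟩ := ih j (by omega) a b hj
      refine ⟨v * c, ?_⟩
      push_cast
      have h3 : (7 : R) * (a : R) - 7 * (b : R) * π = 7 * ((a : R) - (b : R) * π) := by ring
      rw [h3, hc, h7]
      ring

/-- `7^{jα} ∣ α₀² + 7α₁²` for `jα := (α₀² + 7α₁²).toNat.factorization 7` — the letter of `DualExpValueDatum.jα`/`normA`.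
[cite: Kato2004Asterisque, (15.16.1) (p. 265)] -/
theorem seven_pow_factorization_dvd_norm (α₀ α₁ : ℤ) :
    (7 : ℤ) ^ ((α₀ ^ 2 + 7 * α₁ ^ 2).toNat.factorization 7) ∣ α₀ ^ 2 + 7 * α₁ ^ 2 := by
  set n : ℕ := (α₀ ^ 2 + 7 * α₁ ^ 2).toNat with hn
  have hnn : (0 : ℤ) ≤ α₀ ^ 2 + 7 * α₁ ^ 2 := by positivity
  have hcast : (n : ℤ) = α₀ ^ 2 + 7 * α₁ ^ 2 := Int.toNat_of_nonneg hnn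
  have h : 7 ^ n.factorization 7 ∣ n := Nat.ordProj_dvd n 7
  have h' : ((7 ^ n.factorization 7 : ℕ) : ℤ) ∣ (n : ℤ) := Int.natCast_dvd_natCast.mpr h
  rw [hcast] at h'
  exact_mod_cast h'

/-- **The D916 divisibility input from an integer inequality (general `t`-gauge).**  With `jα := v₇(α₀² + 7α₁²)`
(as `.toNat.factorization 7`), `cZ := (α₀ − α₁π)·7^e·(w·(7^k·(u·π^a)))` (the body of `DualExpValueDatum.cZ`) and
`t′ = w′·π^{m′}`:  `m₀ + 2jα ≤ jα + (2e + 2k + a) + m′ ⟹ π^(m₀ + 2jα) ∣ cZ·t′`.  No unit hypothesis on `v, w, u, w′` is needed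
for this direction. [cite: Kato2004Asterisque, (15.16.1) (p. 265)] -/
theorem pow_dvd_constZ_mul_of_le (π v : R) (h7 : (7 : R) = v * π ^ 2) (α₀ α₁ : ℤ) (e k a m₀ m' : ℕ)
    (w u w' : R)
    (hle : m₀ + 2 * (α₀ ^ 2 + 7 * α₁ ^ 2).toNat.factorization 7 ≤
      (α₀ ^ 2 + 7 * α₁ ^ 2).toNat.factorization 7 + (2 * e + 2 * k + a) + m') :
    π ^ (m₀ + 2 * (α₀ ^ 2 + 7 * α₁ ^ 2).toNat.factorization 7) ∣
      ((((α₀ : R) - (α₁ : R) * π) * (7 : R) ^ e) * (w * ((7 : R) ^ k * (u * π ^ a)))) * (w' * π ^ m') := by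
  set j : ℕ := (α₀ ^ 2 + 7 * α₁ ^ 2).toNat.factorization 7 with hj
  obtain ⟨c, hc⟩ := pow_dvd_intCast_sub_intCast_mul π v h7 j α₀ α₁ (seven_pow_factorization_dvd_norm α₀ α₁)
  have hpow : π ^ (m₀ + 2 * j) ∣ π ^ (j + (2 * e + 2 * k + a) + m') := pow_dvd_pow π hle
  have hshape : ((((α₀ : R) - (α₁ : R) * π) * (7 : R) ^ e) * (w * ((7 : R) ^ k * (u * π ^ a)))) * (w' * π ^ m') =
      π ^ (j + (2 * e + 2 * k + a) + m') * (c * v ^ e * w * v ^ k * u * w') := by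
    rw [hc, h7]
    ring
  rw [hshape]
  exact hpow.mul_right _

/-- **The `t = t′ = 1`, `m₀ = 0` gauge** (FEXISTS addendum `t := 1`, pen D907): `jα ≤ 2e + 2k + a ⟹ π^(2jα) ∣ cZ` — the
hypothesis is the (F-b) pre-registration's `PeriodPositionField` verbatim (`FbPreregistration-g65.md` §5), predicted to hold
with EQUALITY `jα = 2(e+k) + a_W` on genuine data (§2 (P1)). [cite: Kato2004Asterisque, (15.16.1) (p. 265)] -/
theorem pow_dvd_constZ_of_le (π v : R) (h7 : (7 : R) = v * π ^ 2) (α₀ α₁ : ℤ) (e k a : ℕ) (w u : R)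
    (hle : (α₀ ^ 2 + 7 * α₁ ^ 2).toNat.factorization 7 ≤ 2 * e + 2 * k + a) :
    π ^ (2 * (α₀ ^ 2 + 7 * α₁ ^ 2).toNat.factorization 7) ∣
      (((α₀ : R) - (α₁ : R) * π) * (7 : R) ^ e) * (w * ((7 : R) ^ k * (u * π ^ a))) := by
  have h := pow_dvd_constZ_mul_of_le π v h7 α₀ α₁ e k a 0 0 w u 1 (by omega)
  simpa using h

end Divisibility

end Summit.BirchSwinnertonDyer.Rank1Residual.Additive.GenusSeven.FbKernelInteger

/-! ## §2 (REV 1.1) The letter on the LANDED datum: `PeriodPositionField D ⟹ Φ.π ^ (m₀ + 2·D.jα) ∣ D.cZ * t′`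

Over the tree's `DualExpValueDatum hγ Φ` (p781874): the (F-b) pre-registration's datum-side letter (memo §5) in the datum's own named
naturals, and the D916 divisibility input derived from it through §1.  `D.cZ`, `D.jα`, `D.normA`, `D.e`, `D.uStar`, `Φ.k`, `Φ.a`, `Φ.u`,
`Φ.v`, `Φ.π`, `Φ.seven_eq` are the TREE's declarations (nothing re-declared); the only new definitions are the two `Prop` letters.
HONEST LABEL: the letters are predicates and the theorems are algebra; whether a genuine datum satisfies `PeriodPositionField` is the
PRE-REGISTERED PREDICTION (P1′) of `FbPreregistration-g65.md` §2bis (predicted with EQUALITY), not a theorem here. -/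

namespace Summit.BirchSwinnertonDyer.Rank1Residual.Additive.GenusSeven

open scoped NumberField TensorProduct
open Field IsDedekindDomain NumberField
open Literature.NumberTheory.GaloisRepresentations
open Literature.NumberTheory.EllipticCurves
open Literature.NumberTheory.EllipticCurves.Rank1Residual
open Literature.NumberTheory.EllipticCurves.IwasawaAlgebra
open Literature.NumberTheory.EllipticCurves.Kato2004
open Literature.NumberTheory.ComplexMultiplication.EllipticUnits
open Summit.BirchSwinnertonDyer.Rank1Residual

section Datum

variable {W : WeierstrassCurve ℚ} [W.IsElliptic] [W.IsGloballyMinimal] [Fact (Nat.Prime 7)]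
  [ContinuousSMul ℤ_[7] (W.tateModule 7)] {K : ZpExtension ℚ 7} {hK : K.IsCyclotomic}
  {γ : Field.absoluteGaloisGroup ℚ} {I : IwasawaH1Data W 7 K γ}
  {F : GenusFrame} {θu : ∀ n : ℕ, globalUnitsOf (F.layer n)} {d : GenusDatum F θu}
  {hγ : K.IsTopGenerator γ} {Φ : PinnedKatoGenusFrame W K hK I d}

namespace FbKernelInteger

/-- **`PeriodPositionField D`** (t-unit gauge, FEXISTS `t := 1`): `v₇(N(α)) ≤ 2e + 2k + a` in the datum's named naturals —
`D.jα ≤ 2·D.e + 2·Φ.k + Φ.a`.  The (F-b) pre-registration predicts EQUALITY on genuine data (`FbPreregistration-g65.md` §2bis (P1′)).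
A predicate; nothing asserted. [cite: Kato2004Asterisque, (15.16.1) (p. 265)] -/
def PeriodPositionField (D : DualExpValueDatum hγ Φ) : Prop :=
  D.jα ≤ 2 * D.e + 2 * Φ.k + Φ.a

/-- **`PeriodPositionFieldAt D m₀ m′`** (general `t`-gauge): with `Φ.t * t′ = Φ.π ^ m₀` and `t′ = w′·Φ.π ^ m′` (so `m₀ − m′ = v_π(t)`),
`D.jα + (m₀ − m′) ≤ 2·D.e + 2·Φ.k + Φ.a`, written subtraction-free.  A predicate; nothing asserted.
[cite: Kato2004Asterisque, (15.16.1) (p. 265)] -/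
def PeriodPositionFieldAt (D : DualExpValueDatum hγ Φ) (m₀ m' : ℕ) : Prop :=
  m₀ + D.jα ≤ 2 * D.e + 2 * Φ.k + Φ.a + m'

/-- The two gauges agree at `m₀ = m′` (in particular at `t = t′ = 1`, `m₀ = m′ = 0`). [cite: Kato2004Asterisque, (15.16.1) (p. 265)] -/
theorem periodPositionFieldAt_self_iff (D : DualExpValueDatum hγ Φ) (m : ℕ) :
    PeriodPositionFieldAt D m m ↔ PeriodPositionField D := by
  unfold PeriodPositionFieldAt PeriodPositionField
  omega

/-- `D.cZ` with its casts normalised: `(α₀ − α₁π)·7^e·(A(uStar⁻¹)·(7^k·(u·π^a)))`. [cite: Kato2004Asterisque, (15.16.1) (p. 265)] -/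
theorem cZ_eq (D : DualExpValueDatum hγ Φ) :
    D.cZ = (((D.α₀ : Φ.R) - (D.α₁ : Φ.R) * Φ.π) * (7 : Φ.R) ^ D.e) *
      (algebraMap (IwasawaAlgebra 7) Φ.R (↑(D.uStar⁻¹) : IwasawaAlgebra 7) *
        ((7 : Φ.R) ^ Φ.k * ((Φ.u : Φ.R) * Φ.π ^ Φ.a))) := by
  simp only [DualExpValueDatum.cZ, map_intCast, map_pow, map_ofNat, Int.cast_pow, Int.cast_ofNat]

/-- **The D916 divisibility input from the integer inequality, general gauge**: for any cofactor `t′ = w′·π^{m′}`,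
`PeriodPositionFieldAt D m₀ m′ ⟹ Φ.π ^ (m₀ + 2·D.jα) ∣ D.cZ * t′`.  (The hypothesis `Φ.t * t′ = Φ.π ^ m₀` of block (R) is not even
needed for this direction.) [cite: Kato2004Asterisque, (15.16.1) (p. 265)] -/
theorem pow_dvd_cZ_mul_of_periodPositionFieldAt (D : DualExpValueDatum hγ Φ) (t' w' : Φ.R) (m₀ m' : ℕ)
    (ht' : t' = w' * Φ.π ^ m') (h : PeriodPositionFieldAt D m₀ m') :
    Φ.π ^ (m₀ + 2 * D.jα) ∣ D.cZ * t' := by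
  have hle : m₀ + 2 * (D.α₀ ^ 2 + 7 * D.α₁ ^ 2).toNat.factorization 7 ≤
      (D.α₀ ^ 2 + 7 * D.α₁ ^ 2).toNat.factorization 7 + (2 * D.e + 2 * Φ.k + Φ.a) + m' := by
    change m₀ + 2 * D.jα ≤ D.jα + (2 * D.e + 2 * Φ.k + Φ.a) + m'
    unfold PeriodPositionFieldAt at h
    omega
  have key := FbKernelInteger.pow_dvd_constZ_mul_of_le Φ.π (Φ.v : Φ.R) Φ.seven_eq D.α₀ D.α₁ D.e Φ.k Φ.a m₀ m'
    (algebraMap (IwasawaAlgebra 7) Φ.R (↑(D.uStar⁻¹) : IwasawaAlgebra 7)) (Φ.u : Φ.R) w' hle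
  rw [cZ_eq, ht']
  exact key

/-- **The `t = t′ = 1` gauge**: `PeriodPositionField D ⟹ Φ.π ^ (2·D.jα) ∣ D.cZ`. [cite: Kato2004Asterisque, (15.16.1) (p. 265)] -/
theorem pow_dvd_cZ_of_periodPositionField (D : DualExpValueDatum hγ Φ) (h : PeriodPositionField D) :
    Φ.π ^ (2 * D.jα) ∣ D.cZ := by
  have h1 := pow_dvd_cZ_mul_of_periodPositionFieldAt D 1 1 0 0 (by simp) ((periodPositionFieldAt_self_iff D 0).2 h)
  simpa using h1

/-- With block (R)'s cofactor hypothesis `Φ.t * t′ = Φ.π ^ m₀` and a unit `t` (`t′ = w′·π^{m₀}`, the (C-t) gauge of the memo),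
the t-unit letter suffices: `PeriodPositionField D ⟹ Φ.π ^ (m₀ + 2·D.jα) ∣ D.cZ * t′`. [cite: Kato2004Asterisque, (15.16.1) (p. 265)] -/
theorem pow_dvd_cZ_mul_of_periodPositionField (D : DualExpValueDatum hγ Φ) (t' w' : Φ.R) (m₀ : ℕ)
    (ht' : t' = w' * Φ.π ^ m₀) (h : PeriodPositionField D) :
    Φ.π ^ (m₀ + 2 * D.jα) ∣ D.cZ * t' :=
  pow_dvd_cZ_mul_of_periodPositionFieldAt D t' w' m₀ m₀ ht' ((periodPositionFieldAt_self_iff D m₀).2 h)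

/-! ### §3 (REV 1.2) The assembly's inputs with the divisibility replaced by the (F-b) letter -/

/-- In the unit-`t` gauge ((C-t); FEXISTS `t := 1` is the case `t = 1`), block (R)'s cofactor identity `Φ.t * t′ = Φ.π ^ m₀` gives
`t′ = t⁻¹·π^{m₀}`. [cite: Kato2004Asterisque, (15.16.1) (p. 265)] -/
theorem cofactor_eq_of_isUnit {t' : Φ.R} {m₀ : ℕ} (ht : Φ.t * t' = Φ.π ^ m₀) (htu : IsUnit Φ.t) :
    t' = (↑(htu.unit⁻¹) : Φ.R) * Φ.π ^ m₀ :=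
  calc t' = ((↑(htu.unit⁻¹) : Φ.R) * Φ.t) * t' := by rw [IsUnit.val_inv_mul, one_mul]
    _ = (↑(htu.unit⁻¹) : Φ.R) * (Φ.t * t') := mul_assoc _ _ _
    _ = (↑(htu.unit⁻¹) : Φ.R) * Φ.π ^ m₀ := by rw [ht]

/-- **`integralComparisonShape_of_inputs` with `hKI` replaced by `IsUnit Φ.t ∧ PeriodPositionField D`** (unit-`t` gauge).
CONDITIONAL; nothing asserted; 19945 OPEN. [cite: Kato2004Asterisque, (15.16.1) (p. 265), 15.14 (p. 264), Thm. 12.4 (2) (p. 221)] -/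
theorem integralComparisonShape_of_inputs_of_periodPositionField (hγ : K.IsTopGenerator γ)
    (Φ : PinnedKatoGenusFrame W K hK I d)
    (D : DualExpValueDatum hγ Φ) (t' : Φ.R) (m₀ : ℕ) (ht : Φ.t * t' = Φ.π ^ m₀)
    (htf : ∀ (f : IwasawaAlgebra 7) (x : Φ.IK.H), f ≠ 0 → f • x = 0 → x = 0)
    (hrk : ∀ x y : Φ.IK.H, ∃ s r₀ r₁ : IwasawaAlgebra 7,
      (s ≠ 0 ∨ r₀ ≠ 0 ∨ r₁ ≠ 0) ∧ s • x = r₀ • y + r₁ • Φ.piK y)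
    (hχ : ∀ n : ℕ, ∃ χ : absoluteGaloisGroup Φ.Kcm →ₜ* ℂˣ,
      (∀ σ ∈ (K.restrictOfFinrankEqTwo (by decide) Φ.Kcm Φ.finrank_Kcm).layerSubgroup (n + 1), χ σ = 1) ∧
        IsPrimitiveRoot (((χ Φ.γK : ℂˣ)) : ℂ) (7 ^ (n + 1)))
    (hL : ∀ χ : absoluteGaloisGroup Φ.Kcm →ₜ* ℂˣ, ∃ Lf : ℂ → ℂ, CM.IsDepletedHeckeL Φ.ψ χ (7 * (7 * F.d)) Lf)
    (hRoh : ∃ n₁ : ℕ, ∀ n : ℕ, n₁ ≤ n → ∀ χ : absoluteGaloisGroup Φ.Kcm →ₜ* ℂˣ,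
      (∀ σ ∈ (K.restrictOfFinrankEqTwo (by decide) Φ.Kcm Φ.finrank_Kcm).layerSubgroup (n + 1), χ σ = 1) →
      IsPrimitiveRoot (((χ Φ.γK : ℂˣ)) : ℂ) (7 ^ (n + 1)) →
      ∀ Lf : ℂ → ℂ, CM.IsDepletedHeckeL Φ.ψ χ (7 * (7 * F.d)) Lf → Lf 1 ≠ 0)
    (htu : IsUnit Φ.t) (hPP : PeriodPositionField D) :
    IntegralComparisonShape Φ :=
  integralComparisonShape_of_inputs hγ Φ D t' m₀ ht htf hrk hχ hL hRoh
    (pow_dvd_cZ_mul_of_periodPositionField D t' _ m₀ (cofactor_eq_of_isUnit ht htu) hPP)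

/-- **General gauge**: `hKI` replaced by a factorisation `t′ = w′·π^{m′}` and `PeriodPositionFieldAt D m₀ m′`.
CONDITIONAL; nothing asserted; 19945 OPEN. [cite: Kato2004Asterisque, (15.16.1) (p. 265), 15.14 (p. 264), Thm. 12.4 (2) (p. 221)] -/
theorem integralComparisonShape_of_inputs_of_periodPositionFieldAt (hγ : K.IsTopGenerator γ)
    (Φ : PinnedKatoGenusFrame W K hK I d)
    (D : DualExpValueDatum hγ Φ) (t' : Φ.R) (m₀ : ℕ) (ht : Φ.t * t' = Φ.π ^ m₀)
    (htf : ∀ (f : IwasawaAlgebra 7) (x : Φ.IK.H), f ≠ 0 → f • x = 0 → x = 0)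
    (hrk : ∀ x y : Φ.IK.H, ∃ s r₀ r₁ : IwasawaAlgebra 7,
      (s ≠ 0 ∨ r₀ ≠ 0 ∨ r₁ ≠ 0) ∧ s • x = r₀ • y + r₁ • Φ.piK y)
    (hχ : ∀ n : ℕ, ∃ χ : absoluteGaloisGroup Φ.Kcm →ₜ* ℂˣ,
      (∀ σ ∈ (K.restrictOfFinrankEqTwo (by decide) Φ.Kcm Φ.finrank_Kcm).layerSubgroup (n + 1), χ σ = 1) ∧
        IsPrimitiveRoot (((χ Φ.γK : ℂˣ)) : ℂ) (7 ^ (n + 1)))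
    (hL : ∀ χ : absoluteGaloisGroup Φ.Kcm →ₜ* ℂˣ, ∃ Lf : ℂ → ℂ, CM.IsDepletedHeckeL Φ.ψ χ (7 * (7 * F.d)) Lf)
    (hRoh : ∃ n₁ : ℕ, ∀ n : ℕ, n₁ ≤ n → ∀ χ : absoluteGaloisGroup Φ.Kcm →ₜ* ℂˣ,
      (∀ σ ∈ (K.restrictOfFinrankEqTwo (by decide) Φ.Kcm Φ.finrank_Kcm).layerSubgroup (n + 1), χ σ = 1) →
      IsPrimitiveRoot (((χ Φ.γK : ℂˣ)) : ℂ) (7 ^ (n + 1)) →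
      ∀ Lf : ℂ → ℂ, CM.IsDepletedHeckeL Φ.ψ χ (7 * (7 * F.d)) Lf → Lf 1 ≠ 0)
    (w' : Φ.R) (m' : ℕ) (ht' : t' = w' * Φ.π ^ m') (hPP : PeriodPositionFieldAt D m₀ m') :
    IntegralComparisonShape Φ :=
  integralComparisonShape_of_inputs hγ Φ D t' m₀ ht htf hrk hχ hL hRoh
    (pow_dvd_cZ_mul_of_periodPositionFieldAt D t' w' m₀ m' ht' hPP)

end FbKernelInteger

end Datum

/-! ### §3 ★″ The v12 stub statement from the (F-b) input form (unit-`t` gauge) -/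

/-- ★″ **`integralComparisonSeven_of_periodPositionInputs`** — the statement of zp v12's `stub_integralComparisonSeven` (VERBATIM, as in
the tree's ★ `integralComparisonSeven_of_inputs`) from the SAME existential input form with its last conjunct `Φ.π ^ (m₀ + 2 * D.jα) ∣ D.cZ * t′`
replaced by `IsUnit Φ.t ∧ FbKernelInteger.PeriodPositionField D` — i.e. by ONE inequality `D.jα ≤ 2 * D.e + 2 * Φ.k + Φ.a` between naturals
of the datum/frame (the (F-b) pre-registration predicts EQUALITY on genuine data).  An ALTERNATIVE residual letter for the pen's v13 touch;
the choice is the pen's.  CONDITIONAL; nothing asserted; no stub closes; 19945 OPEN; BSD claimed for no curve.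
[cite: Kato2004Asterisque, §15.16 (15.16.1) (p. 265), 15.14 (p. 264), Prop. 15.9 (p. 258), Thm. 12.4 (2) / 12.5 (1) (p. 221)] -/
theorem integralComparisonSeven_of_periodPositionInputs
    (h : exists_zetaClassPosition_of_rank_le_one → rank_eq_analyticRank_of_analyticRank_le_one →
      ∀ (W : WeierstrassCurve ℚ) [W.IsElliptic] [W.IsGloballyMinimal] [Fact (Nat.Prime 7)], X12.ClassCSeven W →
      letI : ContinuousSMul ℤ_[7] (W.tateModule 7) := TateModule.continuousSMul_padicInt
      ∀ (K : ZpExtension ℚ 7) (hK : K.IsCyclotomic) (γ : Field.absoluteGaloisGroup ℚ) (hγ : K.IsTopGenerator γ)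
        (I : IwasawaH1Data W 7 K γ),
        ∃ (F : GenusFrame) (θu : ∀ n : ℕ, globalUnitsOf (F.layer n)), IsNormedEllipticUnitFamily F θu ∧
          ∀ d : GenusDatum F θu, ∃ Φ : PinnedKatoGenusFrame W K hK I d, ∃ D : DualExpValueDatum hγ Φ,
            ∃ (t' : Φ.R) (m₀ : ℕ), Φ.t * t' = Φ.π ^ m₀ ∧
            (∀ (f : IwasawaAlgebra 7) (x : Φ.IK.H), f ≠ 0 → f • x = 0 → x = 0) ∧
            (∀ x y : Φ.IK.H, ∃ s r₀ r₁ : IwasawaAlgebra 7,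
              (s ≠ 0 ∨ r₀ ≠ 0 ∨ r₁ ≠ 0) ∧ s • x = r₀ • y + r₁ • Φ.piK y) ∧
            (∀ n : ℕ, ∃ χ : absoluteGaloisGroup Φ.Kcm →ₜ* ℂˣ,
              (∀ σ ∈ (K.restrictOfFinrankEqTwo (by decide) Φ.Kcm Φ.finrank_Kcm).layerSubgroup (n + 1), χ σ = 1) ∧
                IsPrimitiveRoot (((χ Φ.γK : ℂˣ)) : ℂ) (7 ^ (n + 1))) ∧
            (∀ χ : absoluteGaloisGroup Φ.Kcm →ₜ* ℂˣ, ∃ Lf : ℂ → ℂ, CM.IsDepletedHeckeL Φ.ψ χ (7 * (7 * F.d)) Lf) ∧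
            (∃ n₁ : ℕ, ∀ n : ℕ, n₁ ≤ n → ∀ χ : absoluteGaloisGroup Φ.Kcm →ₜ* ℂˣ,
              (∀ σ ∈ (K.restrictOfFinrankEqTwo (by decide) Φ.Kcm Φ.finrank_Kcm).layerSubgroup (n + 1), χ σ = 1) →
              IsPrimitiveRoot (((χ Φ.γK : ℂˣ)) : ℂ) (7 ^ (n + 1)) →
              ∀ Lf : ℂ → ℂ, CM.IsDepletedHeckeL Φ.ψ χ (7 * (7 * F.d)) Lf → Lf 1 ≠ 0) ∧
            IsUnit Φ.t ∧ FbKernelInteger.PeriodPositionField D) :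
    Kato2004.exists_zetaClassPosition_of_rank_le_one → rank_eq_analyticRank_of_analyticRank_le_one →
    ∀ (W : WeierstrassCurve ℚ) [W.IsElliptic] [W.IsGloballyMinimal] [Fact (Nat.Prime 7)], X12.ClassCSeven W →
      letI : ContinuousSMul ℤ_[7] (W.tateModule 7) := TateModule.continuousSMul_padicInt
      ∀ (K : ZpExtension ℚ 7) (hK : K.IsCyclotomic) (γ : Field.absoluteGaloisGroup ℚ) (_ : K.IsTopGenerator γ)
        (I : IwasawaH1Data W 7 K γ),
        ∃ (F : GenusSeven.GenusFrame) (θu : ∀ n : ℕ, globalUnitsOf (F.layer n)), GenusSeven.IsNormedEllipticUnitFamily F θu ∧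
          ∀ d : GenusSeven.GenusDatum F θu, ∃ Φ : GenusSeven.PinnedKatoGenusFrame W K hK I d,
            GenusSeven.IntegralComparisonShape Φ := by
  intro hstar hGZK W _ _ _ hC K hK γ hγ I
  haveI : ContinuousSMul ℤ_[7] (W.tateModule 7) := TateModule.continuousSMul_padicInt
  obtain ⟨F, θu, hpin, hΦ⟩ := h hstar hGZK W hC K hK γ hγ I
  refine ⟨F, θu, hpin, fun d => ?_⟩
  obtain ⟨Φ, D, t', m₀, ht, htf, hrk, hχ, hL, hRoh, htu, hPP⟩ := hΦ d
  exact ⟨Φ, FbKernelInteger.integralComparisonShape_of_inputs_of_periodPositionField hγ Φ D t' m₀ ht htf hrk hχ hL hRoh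
    htu hPP⟩

end Summit.BirchSwinnertonDyer.Rank1Residual.Additive.GenusSeven
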